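import Mathlib
import Literature.Analysis.FluidPDE.VectorCalculus
import Literature.Analysis.FluidPDE.VorticityCalculus
import Literature.Analysis.FluidPDE.WholeSpaceIBP
import Summits.NavierStokesRegularity.NavierStokesRegularity.Theorems.AffineBernoulliAlignedStratumTrivialZeros
import Summits.NavierStokesRegularity.NavierStokesRegularity.Theorems.AffineBernoulliEulerLerayLiouvilleFirstIntegralRigidity
import HarnessLib

/-!
# `AffineBernoulli.AlignedStratumTrivial` — integration tools
  (route `AffineBernoulli`, item stmt-NavierStokesRegularity-13663, helper file V)

* `AlignedStratum.integral_fderiv_add_mul_divergence` — **divergence identity with a test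
  function supported in an open set**: if `G` is `C¹` on the open set `U` (arbitrary elsewhere) and
  `ψ ∈ C¹_c` has `tsupport ψ ⊆ U`, then `y ↦ Dψ(y)[G y] + ψ(y) div G(y)` is integrable with integral
  `0` (it is `div (ψ G)` for the globally `C¹`, compactly supported field `ψ G`).
* `AlignedStratum.norm_mul_fderiv_apply_le_indicator` — pointwise form of the cutoff error:
  `|g · Dη[G]| ≤ 4 M A · 𝟙_{S_ε}`.
* `AlignedStratum.exists_lipschitz_const` — on a closed ball, `curl W` and the similarity field
  are Lipschitz (`W ∈ C²`); hence, at positive distance from the joint zero set `K` inside the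
  ball, `‖curl W y‖, ‖V y‖ ≤ L · infDist y K` (`AlignedStratum.norm_le_mul_infDist`).
* `AlignedStratum.half_le_inner_simField` — far-field outward inequality `⟪y − c, V y⟫ ≥ 1/2` for
  `dist y c ≥ √(2C(1+‖c‖)) + 1` when `‖W‖ ≤ C(1+‖y‖)⁻¹`.

HONEST FRAMING: calculus serving a Liouville lemma about HYPOTHETICAL self-similar Euler profiles;
nothing here bears on the regularity problem itself.
-/

noncomputable section

set_option linter.dupNamespace false

namespace Summit.NavierStokesRegularity.NavierStokesRegularity.Theorems

open Set Function Filter Topology InnerProductSpace MeasureTheory Metric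
open scoped RealInnerProductSpace
open Literature.Analysis.FluidPDE

namespace AlignedStratum

/-! ### The divergence identity with a localised test function -/

/-- **Divergence identity.** `G` of class `C¹` at every point of a set `U`, `ψ ∈ C¹` with compact
support and `tsupport ψ ⊆ U`. Then `F(y) = Dψ(y)[G y] + ψ(y) · div G(y)` is integrable and
`∫ F = 0`. -/
theorem integral_fderiv_add_mul_divergence {U : Set (EuclideanSpace ℝ (Fin 3))}
    {G : EuclideanSpace ℝ (Fin 3) → EuclideanSpace ℝ (Fin 3)} {ψ : EuclideanSpace ℝ (Fin 3) → ℝ}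
    (hG : ∀ y ∈ U, ContDiffAt ℝ 1 G y) (hψ : ContDiff ℝ 1 ψ) (hψc : HasCompactSupport ψ)
    (hψU : tsupport ψ ⊆ U) :
    Integrable (fun y => fderiv ℝ ψ y (G y) + ψ y * VectorCalculus.divergence G y) ∧
      ∫ y, (fderiv ℝ ψ y (G y) + ψ y * VectorCalculus.divergence G y) = 0 := by
  set Φ : EuclideanSpace ℝ (Fin 3) → EuclideanSpace ℝ (Fin 3) := fun y => ψ y • G y with hΦ
  -- `Φ` is globally `C¹`
  have hΦ1 : ContDiff ℝ 1 Φ := by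
    rw [contDiff_iff_contDiffAt]
    intro y
    by_cases hy : y ∈ tsupport ψ
    · exact hψ.contDiffAt.smul (hG y (hψU hy))
    · have hev : Φ =ᶠ[𝓝 y] fun _ => 0 := by
        filter_upwards [(notMem_tsupport_iff_eventuallyEq.1 hy)] with z hz
        simp [hΦ, hz]
      exact (contDiffAt_const (c := (0 : EuclideanSpace ℝ (Fin 3)))).congr_of_eventuallyEq hev
  have hΦc : HasCompactSupport Φ := hψc.smul_right (f' := G)
  -- pointwise identity `div Φ = Dψ[G] + ψ div G`
  have hpt : ∀ y, VectorCalculus.divergence Φ y = fderiv ℝ ψ y (G y) + ψ y * VectorCalculus.divergence G y := by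
    intro y
    by_cases hy : y ∈ tsupport ψ
    · have hGd : DifferentiableAt ℝ G y := (hG y (hψU hy)).differentiableAt one_ne_zero
      rw [divergence_smul_apply (hψ.differentiable one_ne_zero y) hGd, real_inner_comm, gradient,
        InnerProductSpace.toDual_symm_apply]
      ring
    · have h1 : VectorCalculus.divergence Φ y = 0 :=
        divergence_eq_zero_of_notMem_tsupport fun h => hy (tsupport_smul_subset_left ψ G h)
      rw [h1, fderiv_of_notMem_tsupport ℝ hy, image_eq_zero_of_notMem_tsupport hy]
      simp
  have hdc : HasCompactSupport (VectorCalculus.divergence Φ) :=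
    hΦc.mono' fun y hy => by
      by_contra h
      exact hy (divergence_eq_zero_of_notMem_tsupport h)
  have hint : Integrable (fun y => VectorCalculus.divergence Φ y) :=
    (continuous_divergence (hΦ1.continuous_fderiv one_ne_zero)).integrable_of_hasCompactSupport hdc
  have heq : (fun y => fderiv ℝ ψ y (G y) + ψ y * VectorCalculus.divergence G y) =
      fun y => VectorCalculus.divergence Φ y := funext fun y => (hpt y).symm
  rw [heq]
  exact ⟨hint, integral_divergence_eq_zero hΦ1 hΦc⟩

/-! ### Pointwise cutoff error -/

/-- **Pointwise cutoff error.** With `|g| ≤ 1`, `g = 0` off `closedBall c R`,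
`‖G y‖ ≤ A · infDist y K` on that ball at positive distance from `K`, `‖Dη‖ ≤ M/ε`, and `Dη(y) ≠ 0`
only where some point of `K` is within `4ε` and all are beyond `ε/2`:
`|g(y) · Dη(y)[G y]| ≤ 4 M A · 𝟙_{S_ε}(y)`, `S_ε = {dist · c ≤ R, 0 < infDist · K < 4ε}`. -/
theorem norm_mul_fderiv_apply_le_indicator
    {G : EuclideanSpace ℝ (Fin 3) → EuclideanSpace ℝ (Fin 3)}
    {g η : EuclideanSpace ℝ (Fin 3) → ℝ} {K : Set (EuclideanSpace ℝ (Fin 3))}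
    {c : EuclideanSpace ℝ (Fin 3)} {R A M ε : ℝ} (hε : 0 < ε) (hM : 0 ≤ M) (hA : 0 ≤ A)
    (hg1 : ∀ y, |g y| ≤ 1) (hgR : ∀ y, R < dist y c → g y = 0)
    (hGA : ∀ y, dist y c ≤ R → 0 < infDist y K → ‖G y‖ ≤ A * infDist y K)
    (h5 : ∀ y, ‖fderiv ℝ η y‖ ≤ M / ε)
    (h6 : ∀ y, fderiv ℝ η y ≠ 0 → (∃ k ∈ K, dist y k < 4 * ε) ∧ ∀ k ∈ K, ε / 2 < dist y k)
    (y : EuclideanSpace ℝ (Fin 3)) :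
    ‖g y * fderiv ℝ η y (G y)‖ ≤
      {y : EuclideanSpace ℝ (Fin 3) | dist y c ≤ R ∧ 0 < infDist y K ∧ infDist y K < 4 * ε}.indicator
        (fun _ => 4 * M * A) y := by
  set S := {y : EuclideanSpace ℝ (Fin 3) | dist y c ≤ R ∧ 0 < infDist y K ∧ infDist y K < 4 * ε}
    with hS
  by_cases hD : fderiv ℝ η y = 0
  · rw [hD]; simp only [_root_.zero_apply, mul_zero, norm_zero]
    exact Set.indicator_nonneg (fun _ _ => by positivity) y
  obtain ⟨⟨k₀, hk₀, hk₀d⟩, hall⟩ := h6 y hD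
  by_cases hyc : R < dist y c
  · rw [hgR y hyc]; simp only [zero_mul, norm_zero]
    exact Set.indicator_nonneg (fun _ _ => by positivity) y
  rw [not_lt] at hyc
  have hKne : K.Nonempty := ⟨k₀, hk₀⟩
  have hin_lt : infDist y K < 4 * ε := lt_of_le_of_lt (infDist_le_dist_of_mem hk₀) hk₀d
  have hin_pos : 0 < infDist y K :=
    lt_of_lt_of_le (by positivity : 0 < ε / 2) ((le_infDist hKne).2 fun k hk => (hall k hk).le)
  have hyS : y ∈ S := ⟨hyc, hin_pos, hin_lt⟩
  rw [Set.indicator_of_mem hyS, norm_mul, Real.norm_eq_abs]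
  calc |g y| * ‖fderiv ℝ η y (G y)‖ ≤ 1 * (‖fderiv ℝ η y‖ * ‖G y‖) :=
        mul_le_mul (hg1 y) (ContinuousLinearMap.le_opNorm _ _) (norm_nonneg _) zero_le_one
    _ ≤ 1 * (M / ε * (A * (4 * ε))) := by
        refine mul_le_mul_of_nonneg_left ?_ zero_le_one
        refine mul_le_mul (h5 y) ?_ (norm_nonneg _) (by positivity)
        exact (hGA y hyc hin_pos).trans (mul_le_mul_of_nonneg_left hin_lt.le hA)
    _ = 4 * M * A := by field_simp

/-! ### Lipschitz bounds near the zero set -/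

/-- On a closed ball, `curl W` and the similarity field `V y = ½(y − c) + W y` are Lipschitz for
`W ∈ C²` (mean value inequality with the maximum of the continuous derivative on the compact,
convex ball). -/
theorem exists_lipschitz_const {W : EuclideanSpace ℝ (Fin 3) → EuclideanSpace ℝ (Fin 3)}
    (hW : ContDiff ℝ 2 W) (c : EuclideanSpace ℝ (Fin 3)) (R : ℝ) :
    ∃ L : ℝ, 0 ≤ L ∧ ∀ y k, dist y c ≤ R → dist k c ≤ R →
      ‖curl W y - curl W k‖ ≤ L * dist y k ∧
        ‖((1 / 2 : ℝ) • (y - c) + W y) - ((1 / 2 : ℝ) • (k - c) + W k)‖ ≤ L * dist y k := by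
  have hΩ1 : ContDiff ℝ 1 (curl W) := contDiff_curl (n := 1) (by exact_mod_cast hW)
  have hV1 : ContDiff ℝ 1 (fun y => (1 / 2 : ℝ) • (y - c) + W y) :=
    contDiff_simField (hW.of_le (by norm_num))
  obtain ⟨L₁, hL₁⟩ := (isCompact_closedBall c R).exists_bound_of_continuousOn
    ((hΩ1.continuous_fderiv one_ne_zero).continuousOn)
  obtain ⟨L₂, hL₂⟩ := (isCompact_closedBall c R).exists_bound_of_continuousOn
    ((hV1.continuous_fderiv one_ne_zero).continuousOn)
  set L : ℝ := max (max L₁ L₂) 0 with hLdef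
  have hL1 : L₁ ≤ L := (le_max_left L₁ L₂).trans (le_max_left _ 0)
  have hL2 : L₂ ≤ L := (le_max_right L₁ L₂).trans (le_max_left _ 0)
  refine ⟨L, le_max_right _ _, fun y k hy hk => ⟨?_, ?_⟩⟩
  · have h := (convex_closedBall c R).norm_image_sub_le_of_norm_fderiv_le (𝕜 := ℝ)
      (f := curl W) (C := L) (fun x _ => (hΩ1.differentiable one_ne_zero x))
      (fun x hx => (hL₁ x hx).trans hL1)
      (mem_closedBall.2 hk) (mem_closedBall.2 hy)
    rwa [← dist_eq_norm] at h
  · have h := (convex_closedBall c R).norm_image_sub_le_of_norm_fderiv_le (𝕜 := ℝ)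
      (f := fun y => (1 / 2 : ℝ) • (y - c) + W y) (C := L)
      (fun x _ => (hV1.differentiable one_ne_zero x))
      (fun x hx => (hL₂ x hx).trans hL2)
      (mem_closedBall.2 hk) (mem_closedBall.2 hy)
    rwa [← dist_eq_norm] at h

/-- **Linear vanishing at the zero set.** Let `K ⊆ closedBall c R` be compact, consisting of
zeros of the similarity field at which `curl W` also vanishes (the zero-set lemma). Then for
`y ∈ closedBall c R` at positive distance from `K`: `‖curl W y‖ ≤ L · infDist y K` and
`‖½(y − c) + W y‖ ≤ L · infDist y K`, with the Lipschitz constant `L` of the ball. -/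
theorem norm_le_mul_infDist {W : EuclideanSpace ℝ (Fin 3) → EuclideanSpace ℝ (Fin 3)}
    {c : EuclideanSpace ℝ (Fin 3)} {R L : ℝ} {K : Set (EuclideanSpace ℝ (Fin 3))}
    (hK : IsCompact K) (hKR : ∀ k ∈ K, dist k c ≤ R)
    (hKzero : ∀ k ∈ K, (1 / 2 : ℝ) • (k - c) + W k = 0 ∧ curl W k = 0)
    (hL : ∀ y k, dist y c ≤ R → dist k c ≤ R →
      ‖curl W y - curl W k‖ ≤ L * dist y k ∧
        ‖((1 / 2 : ℝ) • (y - c) + W y) - ((1 / 2 : ℝ) • (k - c) + W k)‖ ≤ L * dist y k)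
    {y : EuclideanSpace ℝ (Fin 3)} (hy : dist y c ≤ R) (hpos : 0 < infDist y K) :
    ‖curl W y‖ ≤ L * infDist y K ∧ ‖(1 / 2 : ℝ) • (y - c) + W y‖ ≤ L * infDist y K := by
  have hKne : K.Nonempty := by
    by_contra h
    rw [Set.not_nonempty_iff_eq_empty] at h
    rw [h, infDist_empty] at hpos
    exact lt_irrefl _ hpos
  obtain ⟨k, hk, hdk⟩ := hK.exists_infDist_eq_dist hKne y
  obtain ⟨h1, h2⟩ := hL y k hy (hKR k hk)
  obtain ⟨hVk, hΩk⟩ := hKzero k hk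
  rw [hΩk, sub_zero] at h1
  rw [hVk, sub_zero] at h2
  rw [hdk]
  exact ⟨h1, h2⟩

/-! ### Far field -/

/-- **Far-field outward inequality.** If `‖W y‖ ≤ C(1+‖y‖)⁻¹` (`C ≥ 0`) then for
`dist y c ≥ √(2C(1+‖c‖)) + 1` one has `⟪y − c, ½(y−c) + W y⟫ ≥ 1/2`; in particular the
similarity field does not vanish there. -/
theorem half_le_inner_simField {W : EuclideanSpace ℝ (Fin 3) → EuclideanSpace ℝ (Fin 3)}
    {c : EuclideanSpace ℝ (Fin 3)} {C : ℝ} (hC : 0 ≤ C) (hW : ∀ y, ‖W y‖ ≤ C * (1 + ‖y‖)⁻¹)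
    {y : EuclideanSpace ℝ (Fin 3)} (hy : √(2 * (C * (1 + ‖c‖))) + 1 ≤ dist y c) :
    1 / 2 ≤ ⟪y - c, (1 / 2 : ℝ) • (y - c) + W y⟫ := by
  have h := SimilarityFlow.two_inner_ge (c := c) hC hW y
  have ha : 0 ≤ 2 * (C * (1 + ‖c‖)) := by positivity
  have hs : √(2 * (C * (1 + ‖c‖))) ^ 2 = 2 * (C * (1 + ‖c‖)) := Real.sq_sqrt ha
  have hs0 : 0 ≤ √(2 * (C * (1 + ‖c‖))) := Real.sqrt_nonneg _
  rw [dist_eq_norm] at hy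
  have h2 : 2 * (C * (1 + ‖c‖)) + 1 ≤ ‖y - c‖ ^ 2 := by nlinarith
  linarith

/-- The decay clause gives a nonnegative constant and a uniform bound `‖W y‖ ≤ C`. -/
theorem decay_consts {W : EuclideanSpace ℝ (Fin 3) → EuclideanSpace ℝ (Fin 3)} {C : ℝ}
    (hW : ∀ y, ‖W y‖ ≤ C * (1 + ‖y‖)⁻¹) : 0 ≤ C ∧ ∀ y, ‖W y‖ ≤ C := by
  have hC : 0 ≤ C := by
    have h := hW 0
    have h1 : (0 : ℝ) ≤ C * (1 + ‖(0 : EuclideanSpace ℝ (Fin 3))‖)⁻¹ := (norm_nonneg _).trans h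
    simpa using h1
  refine ⟨hC, fun y => (hW y).trans ?_⟩
  have h1 : (1 + ‖y‖)⁻¹ ≤ 1 := inv_le_one_of_one_le₀ (by linarith [norm_nonneg y])
  calc C * (1 + ‖y‖)⁻¹ ≤ C * 1 := mul_le_mul_of_nonneg_left h1 hC
    _ = C := mul_one C

end AlignedStratum

end Summit.NavierStokesRegularity.NavierStokesRegularity.Theorems
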